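import Mathlib

/-!
# KontsevichZagierPeriods — kz1p LEMMA N (roots of unity in a field of degree ≤ 4 over ℚ), kernel-checked

Tree copy (cell pub-kz1p, seat b2b-kz1p-2, gen 7; LEAN-IN-TREE rule) of `pub-kz1p/numerics/kz1p/lean/LemmaN.lean` (gen 6).
Pure Mathlib mathematics, no named facts, no `sorry`.

PROCEDURE.md §8.5 certifies that the two elliptic factors `E₁′`, `E₂′` of `J(C)` are not
isogenous over `ℚ̄` by comparing the traces `t_n = αⁿ + βⁿ` of Frobenius powers of their
reductions at one good prime `p` for the nine exponents `n ∈ {1,2,3,4,5,6,8,10,12}`.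
The finiteness of that list is LEMMA N, whose arithmetic content is proved here by the kernel:

* `totient_le_four`      : `φ(n) ≤ 4 → n ∈ {1,2,3,4,5,6,8,10,12}`;
* `totient_le_finrank`   : a primitive `n`-th root of unity in a field `K` of characteristic `0`
                           that is finite over `ℚ` forces `φ(n) ≤ [K : ℚ]`
                           (Mathlib: `cyclotomic n ℚ = minpoly ℚ ζ`, i.e. irreducibility of the
                           cyclotomic polynomials over `ℚ`, and `minpoly.natDegree_le`);
* `pow_eq_one_of_finrank_le_four` : in a field `K` with `[K : ℚ] ≤ 4`, `ζ ^ f = 1` with `f ≥ 1`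
                           implies `ζ ^ n = 1` for some `n ∈ {1,2,3,4,5,6,8,10,12}`.

In §8.5 the last statement is applied with `K = ℚ(α₁, α₂) ⊂ ℂ` (compositum of the two imaginary
quadratic fields generated by the Frobenius roots, `[K : ℚ] ≤ 2·2 = 4` by the tower law) and
`ζ = α₂/α₁` resp. `ζ = α₂/β₁`.  No `sorry`, no axioms beyond Mathlib's.
-/

namespace Summit.KontsevichZagierPeriods.KzOnePeriods.LemmaN

/-- `φ(n) ≤ 4` forces `n ∈ {1,2,3,4,5,6,8,10,12}` (for `n ≥ 1`). -/
theorem totient_le_four {n : ℕ} (hn : 0 < n) (h : Nat.totient n ≤ 4) :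
    n ∈ ({1, 2, 3, 4, 5, 6, 8, 10, 12} : Finset ℕ) := by
  -- every divisor `d` of `n` has `φ d ∣ φ n`, hence `φ d ≤ 4`
  have key : ∀ d : ℕ, d ∣ n → Nat.totient d ≤ 4 := fun d hd =>
    le_trans (Nat.le_of_dvd (Nat.totient_pos.mpr hn) (Nat.totient_dvd_of_dvd hd)) h
  have h16 : ¬ (2 ^ 4 ∣ n) := fun hd => absurd (key (2 ^ 4) hd) (by decide)
  have h9 : ¬ (3 ^ 2 ∣ n) := fun hd => absurd (key (3 ^ 2) hd) (by decide)
  have h25 : ¬ (5 ^ 2 ∣ n) := fun hd => absurd (key (5 ^ 2) hd) (by decide)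
  have hp : ∀ p : ℕ, p.Prime → p ∣ n → p ≤ 5 := by
    intro p pp hd
    have := key p hd
    rw [Nat.totient_prime pp] at this
    omega
  -- hence `n ∣ 120 = 2³·3·5`
  have h120 : n ∣ 120 := by
    rw [Nat.dvd_iff_prime_pow_dvd_dvd]
    intro p k pp hk
    rcases Nat.eq_zero_or_pos k with rfl | kpos
    · simp
    have hpn : p ∣ n := (dvd_pow_self p kpos.ne').trans hk
    have hp5 := hp p pp hpn
    have hp2 := pp.two_le
    interval_cases p
    · have hk3 : k ≤ 3 := by
        by_contra hc
        exact h16 ((pow_dvd_pow 2 (by omega)).trans hk)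
      exact (pow_dvd_pow 2 hk3).trans (by decide)
    · have hk1 : k ≤ 1 := by
        by_contra hc
        exact h9 ((pow_dvd_pow 3 (by omega)).trans hk)
      exact (pow_dvd_pow 3 hk1).trans (by decide)
    · exact absurd pp (by decide)
    · have hk1 : k ≤ 1 := by
        by_contra hc
        exact h25 ((pow_dvd_pow 5 (by omega)).trans hk)
      exact (pow_dvd_pow 5 hk1).trans (by decide)
  have hmem : n ∈ Nat.divisors 120 := Nat.mem_divisors.mpr ⟨h120, by decide⟩
  have hdiv : Nat.divisors 120 =
      {1, 2, 3, 4, 5, 6, 8, 10, 12, 15, 20, 24, 30, 40, 60, 120} := by decide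
  rw [hdiv] at hmem
  simp only [Finset.mem_insert, Finset.mem_singleton] at hmem ⊢
  rcases hmem with rfl | rfl | rfl | rfl | rfl | rfl | rfl | rfl | rfl | rfl | rfl | rfl | rfl |
    rfl | rfl | rfl
  all_goals first | decide | exact absurd h (by decide)

/-- A primitive `n`-th root of unity in a field of characteristic `0`, finite over `ℚ`,
forces `φ(n) ≤ [K : ℚ]` (degree of the cyclotomic polynomial = degree of the minimal polynomial). -/
theorem totient_le_finrank {K : Type*} [Field K] [CharZero K] [FiniteDimensional ℚ K]
    {ζ : K} {n : ℕ} (hn : 0 < n) (hζ : IsPrimitiveRoot ζ n) :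
    Nat.totient n ≤ Module.finrank ℚ K := by
  have h2 : (minpoly ℚ ζ).natDegree ≤ Module.finrank ℚ K := minpoly.natDegree_le ζ
  rwa [← Polynomial.cyclotomic_eq_minpoly_rat hζ hn, Polynomial.natDegree_cyclotomic] at h2

/-- LEMMA N, root-of-unity step: in a field `K` with `[K : ℚ] ≤ 4`, any `ζ` with `ζ ^ f = 1`
(`f ≥ 1`) satisfies `ζ ^ n = 1` for some `n ∈ {1,2,3,4,5,6,8,10,12}`. -/
theorem pow_eq_one_of_finrank_le_four {K : Type*} [Field K] [CharZero K] [FiniteDimensional ℚ K]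
    (hK : Module.finrank ℚ K ≤ 4) {ζ : K} {f : ℕ} (hf : 0 < f) (h : ζ ^ f = 1) :
    ∃ n ∈ ({1, 2, 3, 4, 5, 6, 8, 10, 12} : Finset ℕ), ζ ^ n = 1 := by
  have hfin : IsOfFinOrder ζ := isOfFinOrder_iff_pow_eq_one.mpr ⟨f, hf, h⟩
  have hpos : 0 < orderOf ζ := hfin.orderOf_pos
  exact ⟨orderOf ζ, totient_le_four hpos ((totient_le_finrank hpos (IsPrimitiveRoot.orderOf ζ)).trans hK),
    pow_orderOf_eq_one ζ⟩

/-- The list is sharp: each of the nine values has `φ ≤ 4`. -/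
theorem totient_le_four_sharp :
    ∀ n ∈ ({1, 2, 3, 4, 5, 6, 8, 10, 12} : Finset ℕ), Nat.totient n ≤ 4 := by decide

end Summit.KontsevichZagierPeriods.KzOnePeriods.LemmaN
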